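import Summits.RiemannHypothesis.RiemannHypothesis.Theorems.WeilBochnerMeasureSpectral
import Summits.RiemannHypothesis.RiemannHypothesis.Theorems.WeilBochnerMeasureCountingAsymptotics
import Literature.NumberTheory.LFunctions.WeilBochnerRepresentationRH
import Literature.NumberTheory.LFunctions.UniformWeilPositivityRH
import HarnessLib

/-!
# RiemannHypothesis — what a rung IS: a positive spectral measure for the explicit formula on the window

Helper file (`--supports stmt-RiemannHypothesis-0098`), RH-free, standard axioms.  Seat rh-explicit
weil-3 (structure).

* `weilPositivityOn_of_forall_lt`: **the positivity ladder is left-closed** — if `WeilPositivityOn b'`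
  for every `b' < b` then `WeilPositivityOn b` (dilate a test of the closed window into the open one;
  `Q` is continuous along dilations).  So `{b | WeilPositivityOn b}` is a closed down-set.
* **`weilPositivityOn_iff_exists_spectral_measure`** (`b > 0`):
  `WeilPositivityOn b ↔ ∃ μ ≥ 0 on ℝ, ∀ smooth k with tsupport k ⊆ [-a, a], a < 2b:
  k̂(½+i·) ∈ L¹(μ) ∧ ∫ k̂(½+it) dμ(t) = W(k)` — a rung of the ladder IS the statement that Weil's
  explicit-formula distribution, restricted to observables of prime-side support `< 2b`, is the
  Fourier transform of a positive measure on the critical line (`→`: `exists_measure_of_weilPositivityOn`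
  + `integral_weilMellin_eq_weilFunctional`; `←`: `W(g ⋆ g̃) = ∫ ‖ĝ‖² dμ ≥ 0` on every smaller window,
  then left-closedness).
* **`riemannHypothesis_iff_exists_spectral_measure`**: `RH ↔ ∃ μ ≥ 0 on ℝ, ∀ smooth compactly
  supported k: ∫ k̂(½+it) dμ(t) = W(k)` — the Riemann hypothesis is EQUIVALENT to: Weil's
  explicit-formula distribution is (the Fourier transform of) a positive measure on the critical line
  (Bochner form of Weil's criterion for the LINEAR functional; `→` the zero-counting measure,
  `←` every window is a rung, then `riemannHypothesis_iff_forall_weilPositivityOn`).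
* `exists_spectral_measure_8046`: the unconditional instance at the tree's frontier rung — a positive
  regular measure on `Re s = ½` which reproduces the explicit formula of every test of prime-side
  support `< 8046/5000` (the prime powers `2, 3, 4` enter) and obeys the Riemann–von Mangoldt counting
  law and the local density law.
-/

noncomputable section

set_option linter.dupNamespace false  -- the mandated namespace repeats `RiemannHypothesis`

open Complex Filter Set MeasureTheory
open scoped Real Topology ComplexConjugate
open Literature.NumberTheory.LFunctions

namespace Summit.RiemannHypothesis.RiemannHypothesis.Theorems.WeilBochnerMeasure

variable {b : ℝ} {μ : Measure ℝ}

/-! ## Dilations of a test and of its autocorrelation -/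

section Dilation

variable {g : ℝ → ℂ}

/-- The dilate `x ↦ g(c x)` of a test is a test. -/
theorem isWeilTest_dilate (hg : IsWeilTest g) {c : ℝ} (hc : 0 < c) : IsWeilTest fun x ↦ g (c * x) := by
  refine ⟨hg.1.comp (contDiff_const.mul contDiff_id), ?_⟩
  have h : (fun x ↦ g (c * x)) = g ∘ (Homeomorph.mulLeft₀ c hc.ne') := by
    funext x; simp [Homeomorph.mulLeft₀]
  rw [h]
  exact hg.2.comp_homeomorph _

/-- `tsupport g ⊆ [-b, b]` ⇒ `tsupport (g(c ·)) ⊆ [-b/c, b/c]` for `c > 0`. -/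
theorem tsupport_dilate_subset (hgs : tsupport g ⊆ Icc (-b) b) {c : ℝ} (hc : 0 < c) :
    tsupport (fun x ↦ g (c * x)) ⊆ Icc (-(b / c)) (b / c) := by
  refine closure_minimal (fun x hx ↦ ?_) isClosed_Icc
  rw [Function.mem_support] at hx
  have h := hgs (subset_tsupport _ (Function.mem_support.2 hx))
  simp only [mem_Icc] at h ⊢
  rw [neg_le, le_div_iff₀ hc, le_div_iff₀ hc]
  constructor <;> nlinarith [h.1, h.2]

/-- The autocorrelation of a dilate is the dilated autocorrelation:
`(g(c·) ⋆ (g(c·))̃)(x) = c⁻¹ (g ⋆ g̃)(c x)` for `c > 0`. -/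
theorem weilConv_dilate_weilReflect (g : ℝ → ℂ) {c : ℝ} (hc : 0 < c) (x : ℝ) :
    weilConv (fun y ↦ g (c * y)) (weilReflect fun y ↦ g (c * y)) x =
      (c⁻¹ : ℂ) * weilConv g (weilReflect g) (c * x) := by
  rw [weilConv_apply, weilConv_apply]
  have h : (fun u : ℝ ↦ g (c * u) * weilReflect (fun y ↦ g (c * y)) (x - u)) =
      fun u : ℝ ↦ (fun v : ℝ ↦ g v * weilReflect g (c * x - v)) (c * u) := by
    funext u
    simp only [weilReflect]
    congr 2
    ring_nf
  rw [h, Measure.integral_comp_mul_left (fun v : ℝ ↦ g v * weilReflect g (c * x - v)) c,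
    abs_of_pos (inv_pos.2 hc), ← Complex.coe_smul, Complex.ofReal_inv, smul_eq_mul]

end Dilation

/-! ## Left-closedness of the positivity ladder -/

/-- **The positivity ladder is left-closed.**  If Weil positivity holds on every window `[-b', b']`
with `b' < b`, it holds on `[-b, b]`: for a test `g` of the closed window the dilates `g((1+1/(n+1))·)`
live in open sub-windows, `Q ≥ 0` there, and `Q(g((1+1/(n+1))·)) = W(c_n⁻¹ K(c_n ·)) → W(K) = Q(g)`
(`K = g ⋆ g̃`; polar, prime and archimedean sides converge separately, the last by dominated
convergence). -/
theorem weilPositivityOn_of_forall_lt (h : ∀ b' : ℝ, b' < b → WeilPositivityOn b') :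
    WeilPositivityOn b := by
  intro g hg hgs
  rcases le_or_gt b 0 with hb | hb
  · -- `b ≤ 0`: the support is contained in `{0}`, so `g = 0`
    have hsupp : Function.support g = ∅ := by
      by_contra hne
      rw [← ne_eq, ← Set.nonempty_iff_ne_empty] at hne
      have hopen : IsOpen (Function.support g) := hg.1.continuous.isOpen_support
      obtain ⟨x, hx⟩ := hne
      obtain ⟨ε, hε, hball⟩ := Metric.isOpen_iff.1 hopen x hx
      have h1 : x + ε / 2 ∈ Function.support g := hball (by
        rw [Metric.mem_ball, Real.dist_eq]; rw [show x + ε / 2 - x = ε / 2 by ring, abs_of_pos (by positivity)]; linarith)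
      have hx' := hgs (subset_tsupport _ hx)
      have h1' := hgs (subset_tsupport _ h1)
      simp only [mem_Icc] at hx' h1'
      linarith [hx'.1, h1'.2]
    have hg0 : g = 0 := Function.support_eq_empty_iff.1 hsupp
    rw [hg0, weilQuadratic_zero, Complex.zero_re]
  -- `b > 0`: dilate
  set c : ℕ → ℝ := fun n ↦ 1 + 1 / ((n : ℝ) + 1) with hcdef
  have hc1 : ∀ n, 1 < c n := fun n ↦ by
    have : (0 : ℝ) < 1 / ((n : ℝ) + 1) := by positivity
    simp only [hcdef]
    linarith
  have hc0 : ∀ n, 0 < c n := fun n ↦ by linarith [hc1 n]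
  have hc2 : ∀ n, c n ≤ 2 := fun n ↦ by
    simp only [hcdef]
    have : 1 / ((n : ℝ) + 1) ≤ 1 := by rw [div_le_one (by positivity)]; linarith [(Nat.cast_nonneg n : (0 : ℝ) ≤ n)]
    linarith
  have hclim : Tendsto c atTop (𝓝 1) := by
    have h0 := tendsto_one_div_add_atTop_nhds_zero_nat (𝕜 := ℝ)
    simpa [hcdef] using h0.const_add 1
  set gn : ℕ → ℝ → ℂ := fun n x ↦ g (c n * x) with hgn
  have hgnt : ∀ n, IsWeilTest (gn n) := fun n ↦ isWeilTest_dilate hg (hc0 n)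
  have hQn : ∀ n, 0 ≤ (weilQuadratic (gn n)).re := fun n ↦
    h (b / c n) (by rw [div_lt_iff₀ (hc0 n)]; nlinarith [hc1 n]) (gn n) (hgnt n)
      (tsupport_dilate_subset hgs (hc0 n))
  -- the autocorrelations `K = g ⋆ g̃`, `K_n = c_n⁻¹ K(c_n ·)`
  set K : ℝ → ℂ := weilConv g (weilReflect g) with hK
  have hKt : IsWeilTest K := hg.weilConv hg.weilReflect
  set Kn : ℕ → ℝ → ℂ := fun n ↦ weilConv (gn n) (weilReflect (gn n)) with hKn
  have hKnt : ∀ n, IsWeilTest (Kn n) := fun n ↦ (hgnt n).weilConv (hgnt n).weilReflect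
  have hKn_eq : ∀ n x, Kn n x = ((c n)⁻¹ : ℂ) * K (c n * x) := fun n x ↦
    weilConv_dilate_weilReflect g (hc0 n) x
  have hQ : weilQuadratic g = weilFunctional K := rfl
  have hQn_eq : ∀ n, weilQuadratic (gn n) = weilFunctional (Kn n) := fun n ↦ rfl
  -- pointwise convergence of `K_n` and of its transform
  have hKn_val : ∀ x, Tendsto (fun n ↦ Kn n x) atTop (𝓝 (K x)) := by
    intro x
    simp only [hKn_eq]
    have hcC : Tendsto (fun n ↦ (c n : ℂ)) atTop (𝓝 ((1 : ℝ) : ℂ)) :=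
      (Complex.continuous_ofReal.tendsto _).comp hclim
    have h1 : Tendsto (fun n ↦ ((c n : ℂ))⁻¹) atTop (𝓝 (((1 : ℝ) : ℂ))⁻¹) := hcC.inv₀ (by simp)
    have h2 : Tendsto (fun n ↦ K (c n * x)) atTop (𝓝 (K (1 * x))) :=
      (hKt.1.continuous.tendsto _).comp ((hclim.mul_const x))
    simpa using h1.mul h2
  have hKn_mellin : ∀ n s, weilMellin (Kn n) s = ((c n)⁻¹ : ℂ) * ((c n : ℂ)⁻¹ *
      weilMellin K (1 / 2 + (s - 1 / 2) / c n)) := by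
    intro n s
    have h := SpectralTraceWindowTraceArch.stub_bandlimitedTest_weilMellin_dilate K (hc0 n) s
    rw [← h, ← weilMellin_const_mul]
    exact congrArg (weilMellin · s) (funext (hKn_eq n))
  have hKn_lim : ∀ s, Tendsto (fun n ↦ weilMellin (Kn n) s) atTop (𝓝 (weilMellin K s)) := by
    intro s
    simp only [hKn_mellin]
    have hcC : Tendsto (fun n ↦ (c n : ℂ)) atTop (𝓝 ((1 : ℝ) : ℂ)) :=
      (Complex.continuous_ofReal.tendsto _).comp hclim
    have h1 : Tendsto (fun n ↦ ((c n : ℂ))⁻¹) atTop (𝓝 (((1 : ℝ) : ℂ))⁻¹) := hcC.inv₀ (by simp)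
    have h2 : Tendsto (fun n ↦ (1 : ℂ) / 2 + (s - 1 / 2) / c n) atTop
        (𝓝 ((1 : ℂ) / 2 + (s - 1 / 2) / ((1 : ℝ) : ℂ))) :=
      tendsto_const_nhds.add (tendsto_const_nhds.div hcC (by simp))
    have h3 := ((continuous_weilMellin hKt.1.continuous hKt.2).tendsto _).comp h2
    have h4 := h1.mul (h1.mul h3)
    simp only [Complex.ofReal_one, inv_one, one_mul, div_one, add_sub_cancel, Function.comp_def] at h4
    exact h4
  -- uniform support and the prime term
  obtain ⟨R, hR0, hR⟩ := WeilContinuous.exists_support_radius hKt.2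
  have hKnR : ∀ n, ∀ x : ℝ, R < |x| → Kn n x = 0 := by
    intro n x hx
    rw [hKn_eq, hR _ ?_, mul_zero]
    rw [abs_mul, abs_of_pos (hc0 n)]
    nlinarith [mul_nonneg (sub_nonneg.2 (hc1 n).le) (abs_nonneg x)]
  have hprime : Tendsto (fun n ↦ weilPrimeTerm (Kn n)) atTop (𝓝 (weilPrimeTerm K)) := by
    rw [WeilContinuous.weilPrimeTerm_eq_sum_of_support hR]
    simp_rw [WeilContinuous.weilPrimeTerm_eq_sum_of_support (hKnR _)]
    refine tendsto_finsetSum _ fun m _ ↦ ?_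
    exact tendsto_const_nhds.mul ((hKn_val _).add (hKn_val _))
  -- the polar term
  have hpolar : Tendsto (fun n ↦ weilPolarTerm (Kn n)) atTop (𝓝 (weilPolarTerm K)) := by
    unfold weilPolarTerm
    exact (hKn_lim 0).add (hKn_lim 1)
  -- the archimedean integral (dominated convergence)
  set D : ℝ := weilDecayConst g with hD
  have hsre : ∀ u : ℝ, ((1 : ℂ) / 2 + u * I).re = 1 / 2 := fun u ↦ by simp
  have hsim : ∀ u : ℝ, ((1 : ℂ) / 2 + u * I).im = u := fun u ↦ by simp
  have hdec : ∀ u : ℝ, ‖weilMellin g (1 / 2 + u * I)‖ ≤ D / (1 + u ^ 2) := fun u ↦ by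
    have h := norm_weilMellin_le hg (s := 1 / 2 + u * I) (by rw [hsre]; norm_num) (by rw [hsre]; norm_num)
    rwa [hsim] at h
  have hD0 : 0 ≤ D := by
    have h := (norm_nonneg _).trans (hdec 0)
    simpa using h
  have hbd : ∀ (n : ℕ) (t : ℝ), ‖weilMellin (Kn n) (1 / 2 + t * I)‖ ≤ 16 * D ^ 2 * (1 + t ^ 2)⁻¹ := by
    intro n t
    rw [hKn, weilMellin_weilConv_weilReflect_half (hgnt n), Complex.norm_real, Real.norm_eq_abs,
      abs_of_nonneg (by positivity)]
    have hd := SpectralTraceWindowTraceArch.stub_bandlimitedTest_weilMellin_dilate g (hc0 n) (1 / 2 + t * I)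
    have e : (1 : ℂ) / 2 + (1 / 2 + t * I - 1 / 2) / (c n : ℂ) = 1 / 2 + ((t / c n : ℝ) : ℂ) * I := by
      have : (c n : ℂ) ≠ 0 := by exact_mod_cast (hc0 n).ne'
      push_cast; field_simp; ring
    have hgn_eq : weilMellin (gn n) (1 / 2 + t * I) = ((c n : ℂ))⁻¹ * weilMellin g (1 / 2 + ((t / c n : ℝ) : ℂ) * I) := by
      simp only [hgn]; rw [hd, e]
    have h1 : ‖weilMellin g (1 / 2 + ((t / c n : ℝ) : ℂ) * I)‖ ≤ D / (1 + (t / c n) ^ 2) :=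
      hdec (t / c n)
    have h2 : ‖weilMellin (gn n) (1 / 2 + t * I)‖ ≤ D / (1 + (t / c n) ^ 2) := by
      rw [hgn_eq, norm_mul, norm_inv, Complex.norm_real, Real.norm_eq_abs, abs_of_pos (hc0 n)]
      calc (c n)⁻¹ * ‖weilMellin g (1 / 2 + ((t / c n : ℝ) : ℂ) * I)‖
          ≤ 1 * (D / (1 + (t / c n) ^ 2)) :=
            mul_le_mul (inv_le_one_of_one_le₀ (hc1 n).le) h1 (norm_nonneg _) zero_le_one
        _ = D / (1 + (t / c n) ^ 2) := one_mul _
    have h3 : 1 / (1 + (t / c n) ^ 2) ≤ 4 / (1 + t ^ 2) := by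
      have hk : t ^ 2 ≤ 4 * (t / c n) ^ 2 := by
        rw [div_pow, ← mul_div_assoc, le_div_iff₀ (by positivity)]
        nlinarith [mul_nonneg (sq_nonneg t) (by nlinarith [hc2 n, hc0 n] : (0 : ℝ) ≤ 4 - c n ^ 2)]
      rw [div_le_div_iff₀ (by positivity) (by positivity)]
      nlinarith
    have h4 : D / (1 + (t / c n) ^ 2) ≤ 4 * D / (1 + t ^ 2) := by
      have := mul_le_mul_of_nonneg_left h3 hD0
      calc D / (1 + (t / c n) ^ 2) = D * (1 / (1 + (t / c n) ^ 2)) := by ring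
        _ ≤ D * (4 / (1 + t ^ 2)) := this
        _ = 4 * D / (1 + t ^ 2) := by ring
    have h5 : ‖weilMellin (gn n) (1 / 2 + t * I)‖ ≤ 4 * D / (1 + t ^ 2) := h2.trans h4
    calc ‖weilMellin (gn n) (1 / 2 + t * I)‖ ^ 2 ≤ (4 * D / (1 + t ^ 2)) ^ 2 :=
          pow_le_pow_left₀ (norm_nonneg _) h5 2
      _ = 16 * D ^ 2 * (1 + t ^ 2)⁻¹ * (1 + t ^ 2)⁻¹ := by rw [div_eq_mul_inv]; ring
      _ ≤ 16 * D ^ 2 * (1 + t ^ 2)⁻¹ * 1 := by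
          refine mul_le_mul_of_nonneg_left ?_ (by positivity)
          exact inv_le_one_of_one_le₀ (by nlinarith [sq_nonneg t])
      _ = 16 * D ^ 2 * (1 + t ^ 2)⁻¹ := by ring
  have harch : Tendsto (fun n ↦ weilArchIntegral (Kn n)) atTop (𝓝 (weilArchIntegral K)) :=
    SpectralTraceWindowTraceArch.stub_bandlimitedTest_arch_tendsto (fun n ↦ (hKnt n).1.continuous)
      (fun n ↦ (hKnt n).2) hbd (fun t ↦ hKn_lim _)
  -- assemble
  have hW : Tendsto (fun n ↦ weilFunctional (Kn n)) atTop (𝓝 (weilFunctional K)) := by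
    unfold weilFunctional weilArchTerm
    exact (hpolar.sub hprime).add ((harch.const_mul _).sub ((hKn_val 0).mul_const _))
  have hre : Tendsto (fun n ↦ (weilQuadratic (gn n)).re) atTop (𝓝 (weilQuadratic g).re) := by
    simp only [hQn_eq, hQ]
    exact (Complex.continuous_re.tendsto _).comp hW
  exact ge_of_tendsto' hre hQn

/-! ## A rung IS a positive spectral measure on the open window -/

/-- **What a rung is.**  For `b > 0`: `WeilPositivityOn b` holds iff there is a positive measure `μ`
on `ℝ` such that for every smooth test `k` with `tsupport k ⊆ [-a, a]`, `a < 2b`, the transform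
`k̂(½+i·)` is `μ`-integrable and `∫ k̂(½+it) dμ(t) = W(k)` — i.e. Weil's explicit-formula distribution
on the open window `(-2b, 2b)` is the Fourier transform of a positive measure on the critical line.
(`→`: Bochner–Kreĭn measure + `integral_weilMellin_eq_weilFunctional`; `←`: `Q(g) = ∫ ‖ĝ‖² dμ ≥ 0`
on every smaller window, then `weilPositivityOn_of_forall_lt`.) -/
theorem weilPositivityOn_iff_exists_spectral_measure (hb : 0 < b) :
    WeilPositivityOn b ↔ ∃ μ : Measure ℝ, ∀ k : ℝ → ℂ, IsWeilTest k → ∀ a : ℝ, a < 2 * b →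
      tsupport k ⊆ Icc (-a) a →
        Integrable (fun t : ℝ ↦ weilMellin k (1 / 2 + t * I)) μ ∧
          ∫ t, weilMellin k (1 / 2 + t * I) ∂μ = weilFunctional k := by
  constructor
  · intro hpos
    obtain ⟨μ, -, hμ⟩ := WeilBochner.exists_measure_of_weilPositivityOn hb hpos
    exact ⟨μ, fun k hk a ha hkt ↦ integral_weilMellin_eq_weilFunctional hb hμ hk ha hkt⟩
  · rintro ⟨μ, hμ⟩
    refine weilPositivityOn_of_forall_lt fun b' hb' g hg hgs ↦ ?_
    set K := weilConv g (weilReflect g) with hK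
    have hKt : IsWeilTest K := hg.weilConv hg.weilReflect
    have hKs : tsupport K ⊆ Icc (-(2 * b')) (2 * b') := tsupport_weilConv_weilReflect_subset hg.2 hgs
    obtain ⟨-, hint⟩ := hμ K hKt (2 * b') (by linarith) hKs
    have hQ : weilQuadratic g = weilFunctional K := rfl
    rw [hQ, ← hint]
    have hline : ∀ t : ℝ, weilMellin K (1 / 2 + t * I) = ((‖weilMellin g (1 / 2 + t * I)‖ ^ 2 : ℝ) : ℂ) :=
      fun t ↦ weilMellin_weilConv_weilReflect_half hg t
    simp_rw [hline]
    rw [integral_complex_ofReal, Complex.ofReal_re]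
    exact integral_nonneg fun t ↦ by positivity

/-! ## RH ⟺ the explicit formula has a positive spectral measure on the critical line -/

/-- **Bochner form of Weil's criterion (linear functional).**  The Riemann hypothesis holds iff there
is a positive measure `μ` on `ℝ` such that for every smooth compactly supported `k` the transform
`k̂(½+i·)` is `μ`-integrable and `∫ k̂(½+it) dμ(t) = W(k)`: Weil's explicit-formula distribution is a
positive measure on the critical line.  Under RH `μ = Σ_ρ m_ρ δ_{Im ρ}`
(`WeilBochner.exists_measure_of_riemannHypothesis` represents the squares; the window theorem
`integral_weilMellin_eq_weilFunctional` upgrades to all tests); conversely such a `μ` makes every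
window a rung (`weilPositivityOn_iff_exists_spectral_measure`), hence RH
(`riemannHypothesis_iff_forall_weilPositivityOn`). -/
theorem riemannHypothesis_iff_exists_spectral_measure :
    _root_.RiemannHypothesis ↔ ∃ μ : Measure ℝ, ∀ k : ℝ → ℂ, IsWeilTest k →
      Integrable (fun t : ℝ ↦ weilMellin k (1 / 2 + t * I)) μ ∧
        ∫ t, weilMellin k (1 / 2 + t * I) ∂μ = weilFunctional k := by
  constructor
  · intro hRH
    obtain ⟨μ, hμ⟩ := WeilBochner.exists_measure_of_riemannHypothesis hRH
    refine ⟨μ, fun k hk ↦ ?_⟩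
    obtain ⟨R, hR0, hR⟩ := WeilContinuous.exists_support_radius hk.2
    have hkt : tsupport k ⊆ Icc (-R) R := by
      refine closure_minimal (fun x hx ↦ ?_) isClosed_Icc
      rw [Function.mem_support] at hx
      by_contra hxR
      rw [mem_Icc, not_and_or, not_le, not_le] at hxR
      refine hx (hR x ?_)
      rcases hxR with h | h
      · rw [abs_of_neg (by linarith)]; linarith
      · rw [abs_of_pos (by linarith)]; linarith
    exact integral_weilMellin_eq_weilFunctional (b := R + 1) (by linarith) (fun g hg _ ↦ hμ g hg) hk
      (by linarith) hkt
  · rintro ⟨μ, hμ⟩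
    rw [riemannHypothesis_iff_forall_weilPositivityOn]
    intro b hb
    exact (weilPositivityOn_iff_exists_spectral_measure hb).2 ⟨μ, fun k hk a _ _ ↦ hμ k hk⟩

/-! ## The unconditional instance at the frontier rung -/

/-- **Unconditional spectral measure at the frontier rung.**  There is a positive regular Borel measure
`μ` on `ℝ` such that (i) for every smooth test `k` of prime-side support `tsupport k ⊆ [-a, a]`,
`a < 8046/5000` (the prime powers `2, 3, 4 < e^{1.6092}` enter the explicit formula) the transform
`k̂(½+i·)` is `μ`-integrable and `∫ k̂(½+it) dμ(t) = W(k) = k̂(0) + k̂(1) − Σ_n Λ(n)n^{-½}(k(log n) +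
k(−log n)) + (1/2π)∫ k̂(½+it) Re ψ(¼+it/2) dt − k(0) log π`; (ii) `μ` obeys the Riemann–von Mangoldt
counting law `|μ[0,T] − θ(T)/π|, |μ[-T,0] − θ(T)/π| ≤ C(1 + log(1+T))`; (iii) the local density law
`μ(T, T+1] ≤ C'(1 + log(2+T))`.  From the tree's rung `WeilPositivityOn (4023/5000)`; no hypothesis
on the zeros of `ζ`. -/
theorem exists_spectral_measure_8046 :
    ∃ μ : Measure ℝ, μ.Regular ∧
      (∀ k : ℝ → ℂ, IsWeilTest k → ∀ a : ℝ, a < 8046 / 5000 → tsupport k ⊆ Icc (-a) a →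
        Integrable (fun t : ℝ ↦ weilMellin k (1 / 2 + t * I)) μ ∧
          ∫ t, weilMellin k (1 / 2 + t * I) ∂μ = weilFunctional k) ∧
      (∃ C : ℝ, ∀ T : ℝ, 0 ≤ T →
        |μ.real (Icc 0 T) - riemannSiegelTheta T / π| ≤ C * (1 + Real.log (1 + T)) ∧
          |μ.real (Icc (-T) 0) - riemannSiegelTheta T / π| ≤ C * (1 + Real.log (1 + T))) ∧
      ∃ C : ℝ, ∀ T : ℝ, 0 ≤ T → μ.real (Ioc T (T + 1)) ≤ C * (1 + Real.log (2 + T)) := by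
  obtain ⟨μ, hreg, hμ⟩ := WeilBochnerRungs.exists_measure_8046
  have hb : (0 : ℝ) < 4023 / 5000 := by norm_num
  refine ⟨μ, hreg, fun k hk a ha hkt ↦ integral_weilMellin_eq_weilFunctional hb hμ hk (by linarith) hkt,
    abs_measureReal_Icc_sub_theta_le hb hμ, measureReal_Ioc_unit_le hb hμ⟩

end Summit.RiemannHypothesis.RiemannHypothesis.Theorems.WeilBochnerMeasure

end
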